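import Mathlib

/-!
# Peeling count — stub `stub_peelCount` of line `Sketch`, crux stmt-PneNP-2463
# (`SolvableImpliesStableSection`)

Path tuples `Ψ : Fin (k+1) → Fin m → Fin k → Fin n × Bool` (`k+1` random `k`-SAT instances,
clause `a` of instance `ρ` has literal slots `Ψ ρ a j = (variable, sign)`).  Along segment `r` of
the path only `Ψ r.castSucc` and `Ψ r.succ` matter; the *pool* of clause `a` is its `2k` slots in
these two instances.  For an injective enumeration `f : Fin u → Fin m` of clauses and parents
`p i < i` (`i ≠ 0`) we bound the number of `Ψ` in which every clause `f i`, `i ≠ 0`, shares a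
pooled variable with its parent `f (p i)`:

  `#E(u, f, p) · n^{u-1} ≤ ((2k)²)^{u-1} · #Paths`,

the first moment of one BFS witness of a large clause-sharing component (used by the assembly of
the low-density block, `stub_lowDensityAssembly`).

Proof: induction on `u` (`pc_nat`), peeling the last clause `a₀ = f last`.  The event for the
first `u` clauses does not read the slots of `a₀`, and given it, "`a₀` shares a pooled variable
with `b₀ = f (p last) ≠ a₀`" is a union over the `(2k)²` pool slot pairs `((ρ, j), (ρ', j'))` of
the events `(Ψ ρ b₀ j).1 = (Ψ ρ' a₀ j').1`, each of conditional probability `1/n` because the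
resampling map `(Ψ, x) ↦ Ψ[(ρ', a₀, j').1 ↦ x]` injects (event `×` `Fin n`) into the conditioning
set (`pc_inject`, `pc_cond`).  Everything is counted in `ℕ` and cast to `ℝ` at the end.
-/

set_option linter.dupNamespace false

namespace Summit.PneNP.PneNP.Cruxes.SolvableImpliesStableSection.Sketch

open Finset
open scoped Classical

/-- Resampling injection.  If `T a x` overwrites a coordinate `π` of `a` by `x` (laws `hπT`, `hTT`,
`hTπ`), leaves the coordinate `g` unchanged and preserves `E`, then `(a, x) ↦ T a x` injects
`{a ∈ E | g a = π a} × β` into `E`; hence `#{a ∈ E | g a = π a} · |β| ≤ #E`. -/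
private theorem pc_inject {α β : Type*} [Fintype β] [DecidableEq β] (T : α → β → α) (π g : α → β)
    (hπT : ∀ a x, π (T a x) = x) (hTT : ∀ a x y, T (T a x) y = T a y) (hTπ : ∀ a, T a (π a) = a)
    (hgT : ∀ a x, g (T a x) = g a) (E : Finset α) (hE : ∀ a ∈ E, ∀ x, T a x ∈ E) :
    (E.filter fun a => g a = π a).card * Fintype.card β ≤ E.card := by
  rw [← card_univ, ← card_product]
  refine card_le_card_of_injOn (fun q => T q.1 q.2) (fun q hq => ?_) fun q hq q' hq' h => ?_
  · simp only [coe_product, coe_filter, coe_univ, Set.mem_prod, Set.mem_setOf_eq, Set.mem_univ,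
      and_true] at hq
    exact hE _ hq.1 _
  · simp only [coe_product, coe_filter, coe_univ, Set.mem_prod, Set.mem_setOf_eq, Set.mem_univ,
      and_true] at hq hq'
    have h' : T q.1 q.2 = T q'.1 q'.2 := h
    have key : ∀ a, g a = π a → ∀ x, T (T a x) (g (T a x)) = a := fun a ha x => by
      rw [hgT, hTT, ha, hTπ]
    have h1 := key q.1 hq.2 q.2
    have h2 := key q'.1 hq'.2 q'.2
    have hx : q.2 = q'.2 := by
      have := congr_arg π h'
      rwa [hπT, hπT] at this
    rw [h'] at h1
    exact Prod.ext (h1.symm.trans h2) hx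

/-- Conditioning step.  Let `E` be a set of path tuples closed under resampling the variable of
any slot of clause `a₀` (`hE`), and `b₀ ≠ a₀`.  Then the tuples of `E` in which `b₀` and `a₀` share
a pooled variable (some pool slot of `b₀` and some pool slot of `a₀` carry the same variable) are at
most `(2k)² · #E / n`: union bound over the `≤ (2k)²` pool slot pairs, `pc_inject` for each pair. -/
private theorem pc_cond (k m n : ℕ) (r : Fin k) (a₀ b₀ : Fin m) (hab : b₀ ≠ a₀)
    (E : Finset (Fin (k + 1) → Fin m → Fin k → Fin n × Bool))
    (hE : ∀ Ψ ∈ E, ∀ (ρ₀ : Fin (k + 1)) (j₀ : Fin k) (x : Fin n),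
      (fun ρ a j => if ρ = ρ₀ ∧ a = a₀ ∧ j = j₀ then (x, (Ψ ρ₀ a₀ j₀).2) else Ψ ρ a j) ∈ E) :
    (E.filter fun Ψ => ∃ j j' : Fin k, ∃ ρ ρ' : Fin (k + 1),
        (ρ = r.castSucc ∨ ρ = r.succ) ∧ (ρ' = r.castSucc ∨ ρ' = r.succ) ∧
        (Ψ ρ b₀ j).1 = (Ψ ρ' a₀ j').1).card * n ≤ (2 * k) ^ 2 * E.card := by
  -- the `≤ (2k)²` pool slot pairs `((j, j'), (ρ, ρ'))`
  set P : Finset (Fin (k + 1)) := {r.castSucc, r.succ} with hP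
  set I : Finset ((Fin k × Fin k) × (Fin (k + 1) × Fin (k + 1))) :=
    (univ ×ˢ univ) ×ˢ (P ×ˢ P) with hI
  have hIcard : I.card ≤ (2 * k) ^ 2 := by
    have hP2 : P.card ≤ 2 := card_le_two
    calc I.card = k * k * (P.card * P.card) := by
          simp only [hI, card_product, card_univ, Fintype.card_fin]
      _ ≤ k * k * (2 * 2) := Nat.mul_le_mul_left _ (Nat.mul_le_mul hP2 hP2)
      _ = (2 * k) ^ 2 := by ring
  -- the event of one slot pair
  set F : (Fin k × Fin k) × (Fin (k + 1) × Fin (k + 1)) →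
      Finset (Fin (k + 1) → Fin m → Fin k → Fin n × Bool) :=
    fun q => E.filter fun Ψ => (Ψ q.2.1 b₀ q.1.1).1 = (Ψ q.2.2 a₀ q.1.2).1 with hF
  -- one slot pair has conditional probability `1/n` (resampling injection)
  have hslot : ∀ q ∈ I, (F q).card * n ≤ E.card := by
    rintro ⟨⟨j, j'⟩, ⟨ρ, ρ'⟩⟩ -
    have h := pc_inject
      (fun (Ψ : Fin (k + 1) → Fin m → Fin k → Fin n × Bool) (x : Fin n) => fun ρ₁ a₁ j₁ =>
        if ρ₁ = ρ' ∧ a₁ = a₀ ∧ j₁ = j' then (x, (Ψ ρ' a₀ j').2) else Ψ ρ₁ a₁ j₁)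
      (fun Ψ => (Ψ ρ' a₀ j').1) (fun Ψ => (Ψ ρ b₀ j).1)
      (fun Ψ x => by simp)
      (fun Ψ x y => by
        funext ρ₁ a₁ j₁
        by_cases hc : ρ₁ = ρ' ∧ a₁ = a₀ ∧ j₁ = j'
        · simp [hc]
        · simp [hc])
      (fun Ψ => by
        funext ρ₁ a₁ j₁
        by_cases hc : ρ₁ = ρ' ∧ a₁ = a₀ ∧ j₁ = j'
        · obtain ⟨rfl, rfl, rfl⟩ := hc
          simp
        · simp [hc])
      (fun Ψ x => by simp [hab])
      E (fun Ψ hΨ x => hE Ψ hΨ ρ' j' x)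
    rw [Fintype.card_fin] at h
    simpa only [hF] using h
  -- union bound
  have hsub : (E.filter fun Ψ => ∃ j j' : Fin k, ∃ ρ ρ' : Fin (k + 1),
      (ρ = r.castSucc ∨ ρ = r.succ) ∧ (ρ' = r.castSucc ∨ ρ' = r.succ) ∧
      (Ψ ρ b₀ j).1 = (Ψ ρ' a₀ j').1) ⊆ I.biUnion F := by
    intro Ψ hΨ
    simp only [mem_filter] at hΨ
    obtain ⟨hΨE, j, j', ρ, ρ', hρ, hρ', h⟩ := hΨ
    simp only [mem_biUnion, mem_filter, hI, hP, hF, mem_product, mem_univ, true_and, mem_insert,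
      mem_singleton, Prod.exists]
    exact ⟨j, j', ρ, ρ', ⟨hρ, hρ'⟩, hΨE, h⟩
  calc _ ≤ (I.biUnion F).card * n := Nat.mul_le_mul_right _ (card_le_card hsub)
    _ ≤ (∑ q ∈ I, (F q).card) * n := Nat.mul_le_mul_right _ card_biUnion_le
    _ = ∑ q ∈ I, (F q).card * n := sum_mul ..
    _ ≤ ∑ q ∈ I, E.card := sum_le_sum hslot
    _ = I.card * E.card := by rw [sum_const, smul_eq_mul]
    _ ≤ (2 * k) ^ 2 * E.card := Nat.mul_le_mul_right _ hIcard

/-- Arithmetic of one peeling step: `A ≤ B`, `B·n ≤ C·E`, `E·n^{t-1} ≤ C^{t-1}·N` give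
`A·n^t ≤ C^t·N` (`t ≥ 1`). -/
private theorem pc_arith {A B C E N n t : ℕ} (ht : 0 < t) (h1 : A ≤ B) (h2 : B * n ≤ C * E)
    (h3 : E * n ^ (t - 1) ≤ C ^ (t - 1) * N) : A * n ^ t ≤ C ^ t * N := by
  obtain ⟨s, rfl⟩ : ∃ s, t = s + 1 := ⟨t - 1, by omega⟩
  rw [Nat.add_sub_cancel] at h3
  calc A * n ^ (s + 1) = A * n * n ^ s := by rw [pow_succ']; ring
    _ ≤ B * n * n ^ s := Nat.mul_le_mul_right _ (Nat.mul_le_mul_right _ h1)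
    _ ≤ C * E * n ^ s := Nat.mul_le_mul_right _ h2
    _ = C * (E * n ^ s) := mul_assoc ..
    _ ≤ C * (C ^ s * N) := Nat.mul_le_mul_left _ h3
    _ = C ^ (s + 1) * N := by rw [pow_succ']; ring

/-- The peeling count in `ℕ`: `#E(u, f, p) · n^{u-1} ≤ ((2k)²)^{u-1} · #Paths`, by induction on `u`.
For `u ≤ 1` the event is everything.  For `u + 1 ≥ 2` the event is contained in
`E' ∩ {b₀ ~ a₀}` with `a₀ = f last`, `b₀ = f (p last)`, `E' = E(u, f ∘ castSucc, p')`, and `E'` does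
not read the slots of `a₀`; conclude with `pc_cond` and the induction hypothesis. -/
private theorem pc_nat (k m n : ℕ) (r : Fin k) (u : ℕ) :
    ∀ (f : Fin u → Fin m), Function.Injective f → ∀ p : Fin u → Fin u,
      (∀ i : Fin u, (i : ℕ) ≠ 0 → p i < i) →
      ((Finset.univ : Finset (Fin (k + 1) → Fin m → Fin k → Fin n × Bool)).filter fun Ψ =>
          ∀ i : Fin u, (i : ℕ) ≠ 0 → ∃ j j' : Fin k, ∃ ρ ρ' : Fin (k + 1),
            (ρ = r.castSucc ∨ ρ = r.succ) ∧ (ρ' = r.castSucc ∨ ρ' = r.succ) ∧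
            (Ψ ρ (f (p i)) j).1 = (Ψ ρ' (f i) j').1).card * n ^ (u - 1)
        ≤ ((2 * k) ^ 2) ^ (u - 1) * Fintype.card (Fin (k + 1) → Fin m → Fin k → Fin n × Bool) := by
  induction u with
  | zero =>
    intro f _ p _
    rw [Finset.filter_true_of_mem fun Ψ _ i => i.elim0, card_univ]
    simp
  | succ u ih =>
    intro f hf p hp
    rcases Nat.eq_zero_or_pos u with rfl | hu
    · rw [Finset.filter_true_of_mem fun Ψ _ i hi => absurd (Fin.val_eq_zero i) hi, card_univ]
      simp
    -- peel the last clause `a₀ = f (last u)`; its parent clause is `b₀ = f (p (last u)) ≠ a₀`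
    have hlast : p (Fin.last u) < Fin.last u := hp _ (by rw [Fin.val_last]; exact hu.ne')
    have hab : f (p (Fin.last u)) ≠ f (Fin.last u) := fun h => hlast.ne (hf h)
    -- the first `u` clauses `f'` and their parents `p'`
    obtain ⟨f', hf'⟩ : ∃ f' : Fin u → Fin m, ∀ i, f' i = f i.castSucc := ⟨_, fun _ => rfl⟩
    have hf'inj : Function.Injective f' := fun i i' h => by
      rw [hf', hf'] at h
      exact Fin.castSucc_injective u (hf h)
    have hf'ne : ∀ i, f' i ≠ f (Fin.last u) := fun i h => by
      rw [hf'] at h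
      exact (Fin.castSucc_lt_last i).ne (hf h)
    obtain ⟨p', hp'⟩ : ∃ p' : Fin u → Fin u, ∀ i : Fin u, (i : ℕ) ≠ 0 → (p' i : ℕ) = p i.castSucc :=
      ⟨fun i => ⟨min (p i.castSucc : ℕ) i, (min_le_right _ _).trans_lt i.isLt⟩, fun i hi => by
        have h : p i.castSucc < i.castSucc := hp _ (by rwa [Fin.val_castSucc])
        exact min_eq_left (Fin.lt_def.1 h).le⟩
    have hp'lt : ∀ i : Fin u, (i : ℕ) ≠ 0 → p' i < i := fun i hi => by
      have h : p i.castSucc < i.castSucc := hp _ (by rwa [Fin.val_castSucc])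
      rw [Fin.lt_def, hp' i hi]
      exact h
    have hp'cs : ∀ i : Fin u, (i : ℕ) ≠ 0 → (p' i).castSucc = p i.castSucc := fun i hi =>
      Fin.ext (by rw [Fin.val_castSucc, hp' i hi])
    -- the induction hypothesis for `E' = E(u, f', p')`
    obtain ⟨E', hIH, hE'⟩ : ∃ E' : Finset (Fin (k + 1) → Fin m → Fin k → Fin n × Bool),
        E'.card * n ^ (u - 1) ≤ ((2 * k) ^ 2) ^ (u - 1) *
          Fintype.card (Fin (k + 1) → Fin m → Fin k → Fin n × Bool) ∧
        ∀ Ψ, Ψ ∈ E' ↔ ∀ i : Fin u, (i : ℕ) ≠ 0 → ∃ j j' : Fin k, ∃ ρ ρ' : Fin (k + 1),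
          (ρ = r.castSucc ∨ ρ = r.succ) ∧ (ρ' = r.castSucc ∨ ρ' = r.succ) ∧
          (Ψ ρ (f' (p' i)) j).1 = (Ψ ρ' (f' i) j').1 :=
      ⟨_, ih f' hf'inj p' hp'lt, fun Ψ => by simp only [mem_filter, mem_univ, true_and]⟩
    -- `E'` does not read the slots of `a₀`
    have hE'inv : ∀ Ψ ∈ E', ∀ (ρ₀ : Fin (k + 1)) (j₀ : Fin k) (x : Fin n),
        (fun ρ a j => if ρ = ρ₀ ∧ a = f (Fin.last u) ∧ j = j₀ then (x, (Ψ ρ₀ (f (Fin.last u)) j₀).2)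
          else Ψ ρ a j) ∈ E' := by
      intro Ψ hΨ ρ₀ j₀ x
      simp only [hE'] at hΨ ⊢
      intro i hi
      obtain ⟨j, j', ρ, ρ', hρ, hρ', h⟩ := hΨ i hi
      refine ⟨j, j', ρ, ρ', hρ, hρ', ?_⟩
      simpa only [hf'ne, false_and, and_false, if_false] using h
    -- `E(u+1, f, p) ⊆ E' ∩ {b₀ ~ a₀}`
    have hsub : ((Finset.univ : Finset (Fin (k + 1) → Fin m → Fin k → Fin n × Bool)).filter fun Ψ =>
        ∀ i : Fin (u + 1), (i : ℕ) ≠ 0 → ∃ j j' : Fin k, ∃ ρ ρ' : Fin (k + 1),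
          (ρ = r.castSucc ∨ ρ = r.succ) ∧ (ρ' = r.castSucc ∨ ρ' = r.succ) ∧
          (Ψ ρ (f (p i)) j).1 = (Ψ ρ' (f i) j').1) ⊆
        E'.filter fun Ψ => ∃ j j' : Fin k, ∃ ρ ρ' : Fin (k + 1),
          (ρ = r.castSucc ∨ ρ = r.succ) ∧ (ρ' = r.castSucc ∨ ρ' = r.succ) ∧
          (Ψ ρ (f (p (Fin.last u))) j).1 = (Ψ ρ' (f (Fin.last u)) j').1 := by
      intro Ψ hΨ
      simp only [mem_filter, mem_univ, true_and] at hΨ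
      rw [mem_filter, hE']
      refine ⟨fun i hi => ?_, hΨ (Fin.last u) (by rw [Fin.val_last]; exact hu.ne')⟩
      obtain ⟨j, j', ρ, ρ', hρ, hρ', h⟩ := hΨ i.castSucc (by rwa [Fin.val_castSucc])
      refine ⟨j, j', ρ, ρ', hρ, hρ', ?_⟩
      rw [hf', hf', hp'cs i hi]
      exact h
    have hcond := pc_cond k m n r (f (Fin.last u)) (f (p (Fin.last u))) hab E' hE'inv
    rw [Nat.add_sub_cancel]
    exact pc_arith hu (card_le_card hsub) hcond hIH

/-- **Stub 5 of line `Sketch` — peeling count (first moment for one BFS witness).** Fix the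
segment `r`, an injective enumeration `f : Fin u → Fin m` of clauses and parents `p i < i`
(`i ≠ 0`).  The path tuples `Ψ` in which, for every `i ≠ 0`, clause `f i` shares a variable with
clause `f (p i)` in the pool of segment `r` (the `2k` literal slots of `Ψ r.castSucc` and `Ψ r.succ`
at that clause) number at most `((2k)²/n)^{u-1} · #Paths`.  Proof: `pc_nat` (peel the clauses
`f (u-1), f (u-2), …`; each has `2k` fresh uniform slots that must hit one of the `≤ 2k` pooled
variables of its parent), cast to `ℝ`. -/
theorem stub_peelCount (k m n : ℕ) (_hn : 1 ≤ n) (r : Fin k) (u : ℕ) (f : Fin u → Fin m)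
    (hf : Function.Injective f) (p : Fin u → Fin u) (hp : ∀ i : Fin u, (i : ℕ) ≠ 0 → p i < i) :
    (((Finset.univ : Finset (Fin (k + 1) → Fin m → Fin k → Fin n × Bool)).filter fun Ψ =>
        ∀ i : Fin u, (i : ℕ) ≠ 0 → ∃ j j' : Fin k, ∃ ρ ρ' : Fin (k + 1),
          (ρ = r.castSucc ∨ ρ = r.succ) ∧ (ρ' = r.castSucc ∨ ρ' = r.succ) ∧
          (Ψ ρ (f (p i)) j).1 = (Ψ ρ' (f i) j').1).card : ℝ) * (n : ℝ) ^ (u - 1)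
      ≤ ((2 * k : ℝ) ^ 2) ^ (u - 1) *
        Fintype.card (Fin (k + 1) → Fin m → Fin k → Fin n × Bool) := by
  have h := pc_nat k m n r u f hf p hp
  exact_mod_cast h

end Summit.PneNP.PneNP.Cruxes.SolvableImpliesStableSection.Sketch
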